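import Summits.NavierStokesRegularity.NavierStokesRegularity.Theorems.ScalingDefectPeepholeDoorSerrinClassical
import Literature.Analysis.FluidPDE.ClassicalSolutionRegionRescale
import HarnessLib

/-!
# ScalingDefectPeepholeDoorSerrinBackward — Serrin's pressure-free interior bounds on the standard backward cylinder

A consumable form of the pressure-free chain (`…SerrinClassical`): **for every order `k`, every `0 < r < 1` and every
`M` there is `K = K(k, r, M)` such that every classical Navier–Stokes solution `(u, p)` (`ν = 1`, `f = 0`) on the unit
backward cylinder `Q(0, 1) = ]-1, 0[ × B(0, 1)` (`parabolicCylinder 1 0`, the cylinder of the tree's `NSBootstrap` /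
`NSBoundedHigherRegularityBounds`) with `|u| ≤ M` there satisfies `‖D_xᵏ u(t, ·)(x)‖ ≤ K` on the whole inner cylinder
`Q(0, r)` — up to the top, with NO hypothesis on the pressure** (Serrin 1962; Chen–Strain–Tsai–Yau 2009, Lemma A.2;
compare `NSBoundedHigherRegularityBounds_holds`, whose constants carry `‖p‖_{3/2}`).  Proof: every point `(t, x)` of
`Q(0, r)` lies inside the inner cylinder of a TRANSLATED centred cylinder `Q*_ρ((T' - ρ², x))` with `ρ = (1 - r)/2`,
`T' = min 0 (t + ρ²/8)`, contained in `Q(0, 1)`; translate (`IsClassicalNSSolutionOnRegion.stRescale_of_isOpen` with unit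
factors) and apply `Serrin.norm_iteratedFDeriv_le_of_classical` with `R = ρ`, `r' = ρ/2`.

Door S30 is a regularity CRITERION inside a HYPOTHETICAL local Type-I blow-up; item 0056 `NoTypeII`
stays OPEN; nothing here bears on NS regularity itself.
-/

noncomputable section

set_option linter.dupNamespace false

namespace Summit.NavierStokesRegularity.NavierStokesRegularity.Theorems.ScalingDefectPeepholeDoor

namespace Serrin

open MeasureTheory Set Function Filter Topology TopologicalSpace Metric InnerProductSpace
open scoped NNReal ENNReal RealInnerProductSpace Laplacian ContDiff
open Literature.Analysis Literature.Analysis.FluidPDE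

set_option maxHeartbeats 1600000 in
/-- **Serrin's pressure-free interior derivative bounds on the unit backward cylinder** (Serrin 1962;
Chen–Strain–Tsai–Yau 2009, Lemma A.2): for `k : ℕ`, `0 < r < 1` and `M` there is `K = K(k, r, M) ≥ 0` such that
every classical Navier–Stokes solution `(u, p)` (`ν = 1`, `f = 0`) on `Q(0,1) = ]-1, 0[ × B(0, 1)` with `|u| ≤ M`
there satisfies `‖D_xᵏ u(t, ·)(x)‖ ≤ K` for all `(t, x) ∈ Q(0, r)`. Nothing is assumed about `p`. [folklore] -/
theorem norm_iteratedFDeriv_le_of_classical_backward (k : ℕ) {r : ℝ} (hr : 0 < r) (hr1 : r < 1) (M : ℝ) :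
    ∃ K : ℝ, 0 ≤ K ∧ ∀ (u : ℝ → EuclideanSpace ℝ (Fin 3) → EuclideanSpace ℝ (Fin 3))
      (p : ℝ → EuclideanSpace ℝ (Fin 3) → ℝ),
      IsClassicalNSSolutionOnRegion
        (parabolicCylinder 1 (0 : ℝ × EuclideanSpace ℝ (Fin 3))) 1 0 u p →
      (∀ q ∈ parabolicCylinder 1 (0 : ℝ × EuclideanSpace ℝ (Fin 3)), ‖u q.1 q.2‖ ≤ M) →
      ∀ q ∈ parabolicCylinder r (0 : ℝ × EuclideanSpace ℝ (Fin 3)), ‖iteratedFDeriv ℝ k (u q.1) q.2‖ ≤ K := by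
  -- the fixed shape
  set ρ : ℝ := (1 - r) / 2 with hρ
  have hρ0 : 0 < ρ := by rw [hρ]; linarith
  have hρ1 : ρ < 1 := by rw [hρ]; linarith
  obtain ⟨K, hK0, hK⟩ := norm_iteratedFDeriv_le_of_classical k (R := ρ) (r' := ρ / 2) (by positivity)
    (by linarith) M
  refine ⟨K, hK0, fun u p hcl hbd q hq => ?_⟩
  obtain ⟨t, x⟩ := q
  simp only [parabolicCylinder, mem_prod, mem_Ioo, mem_ball, dist_zero_right, Prod.fst_zero,
    Prod.snd_zero, zero_sub] at hq
  obtain ⟨⟨ht1, ht0⟩, hx⟩ := hq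
  -- the top time of the auxiliary cylinder
  set T' : ℝ := min 0 (t + ρ ^ 2 / 8) with hT'
  have hT'0 : T' ≤ 0 := min_le_left _ _
  have hT't : T' ≤ t + ρ ^ 2 / 8 := min_le_right _ _
  have htT' : t < T' := by
    rw [hT']; refine lt_min ht0 ?_; have : 0 < ρ ^ 2 / 8 := by positivity
    linarith
  have hrr : r ^ 2 < 1 := by nlinarith
  -- the translated solution `v(s, y) = u(T' + ρ² + s … )`: centre `z₁ = (T', x)` so that the centred cylinder
  -- `Q*_ρ((-ρ², 0))` pulls back to `]T' - 2ρ², T'[ × B(x, ρ) ⊆ Q(0, 1)`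
  set Ω : Set (ℝ × EuclideanSpace ℝ (Fin 3)) := parabolicCylinder 1 (0 : ℝ × EuclideanSpace ℝ (Fin 3)) with hΩ
  have hΩo : IsOpen Ω := isOpen_parabolicCylinder 1 0
  have htr := hcl.stRescale_of_isOpen hΩo one_pos one_pos (show (1 : ℝ) = 1 * 1 by norm_num) T' x
  have e0 : (((1 : ℝ) ^ 2 * 1) • stPull 1 1 T' x
      (0 : ℝ → EuclideanSpace ℝ (Fin 3) → EuclideanSpace ℝ (Fin 3))) = 0 := by
    funext s y; simp [stPull]
  have eν : (1 : ℝ) * 1 / 1 = 1 := by norm_num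
  rw [e0, eν] at htr
  set v : ℝ → EuclideanSpace ℝ (Fin 3) → EuclideanSpace ℝ (Fin 3) := (1 : ℝ) • stPull 1 1 T' x u with hv
  set π : ℝ → EuclideanSpace ℝ (Fin 3) → ℝ := (1 : ℝ) ^ 2 • stPull 1 1 T' x p with hπ
  have hvap : ∀ s y, v s y = u (T' + s) (x + y) := fun s y => by
    simp [hv]
  -- the centred cylinder about `z₁ = (-ρ², 0)` of radius `ρ` lies in the preimage region
  set z₁ : ℝ × EuclideanSpace ℝ (Fin 3) := ((-ρ ^ 2 : ℝ), (0 : EuclideanSpace ℝ (Fin 3))) with hz₁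
  set Qs : Set (ℝ × EuclideanSpace ℝ (Fin 3)) := parabolicCylinderCentered ρ z₁ with hQs
  have hQsub : Qs ⊆ stAffine 1 1 T' x ⁻¹' Ω := by
    intro q hq'
    simp only [hQs, parabolicCylinderCentered, hz₁, mem_prod, mem_Ioo, mem_ball] at hq'
    obtain ⟨⟨hq1, hq2⟩, hq3⟩ := hq'
    have hy : ‖q.2‖ < ρ := by simpa using hq3
    show stAffine 1 1 T' x q ∈ Ω
    rw [show q = (q.1, q.2) from rfl, stAffine_apply]
    simp only [hΩ, parabolicCylinder, mem_prod, mem_Ioo, mem_ball, dist_zero_right, Prod.fst_zero,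
      Prod.snd_zero, zero_sub, one_pow, one_mul, one_smul]
    refine ⟨⟨?_, ?_⟩, ?_⟩
    · have h1 : -2 * ρ ^ 2 < q.1 := by nlinarith
      have h2 : ρ ^ 2 ≤ (1 - r) ^ 2 / 4 := by rw [hρ]; nlinarith
      nlinarith
    · have : q.1 < 0 := by nlinarith
      linarith
    · calc ‖x + q.2‖ ≤ ‖x‖ + ‖q.2‖ := norm_add_le _ _
        _ < r + ρ := by gcongr
        _ < 1 := by rw [hρ]; linarith
  have hvcl : IsClassicalNSSolutionOnRegion Qs 1 0 v π :=
    htr.mono_of_isOpen hQsub (isOpen_parabolicCylinderCentered ρ z₁)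
  have hvbd : ∀ q' ∈ Qs, ‖v q'.1 q'.2‖ ≤ M := by
    intro q' hq'
    have hmem := hQsub hq'
    rw [mem_preimage, show q' = (q'.1, q'.2) from rfl, stAffine_apply] at hmem
    rw [hvap]
    simpa [one_mul, one_smul] using hbd _ hmem
  -- the evaluation point `(t - T', 0)` lies in the inner cylinder `]-(ρ/2)², 0[ × B(0, ρ/2)`
  have hpt : ((t - T', (0 : EuclideanSpace ℝ (Fin 3))) : ℝ × EuclideanSpace ℝ (Fin 3)) ∈
      Ioo (-(ρ / 2) ^ 2) 0 ×ˢ ball (0 : EuclideanSpace ℝ (Fin 3)) (ρ / 2) := by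
    refine ⟨⟨?_, by linarith⟩, mem_ball_self (by positivity)⟩
    have : (ρ / 2) ^ 2 = ρ ^ 2 / 4 := by ring
    rw [this]; linarith
  have h := hK v π hvcl hvbd (t - T', 0) hpt
  -- undo the translation
  have hfun : v (t - T') = fun y => u t (y + x) := by
    funext y; rw [hvap]; congr 1 <;> [ring_nf; rw [add_comm]]
  rw [hfun, iteratedFDeriv_comp_add_right] at h
  simpa using h

end Serrin

end Summit.NavierStokesRegularity.NavierStokesRegularity.Theorems.ScalingDefectPeepholeDoor

end
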